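import Mathlib.NumberTheory.ModularForms.Cusps
import Literature.AnabelianGeometry.AbsoluteAnabelian.ArchimedeanHolFieldFunctorGeometricPSL
import Literature.AnabelianGeometry.AbsoluteAnabelian.LocCategoryGroupModel
import Literature.Geometry.Manifold.QuotientConjugationMap
import HarnessLib

/-!
# `hfin` at ARITHMETIC Fuchsian groups: a conjugate of an arithmetic group contained in an arithmetic group has finite index in it

S. Mochizuki, *Topics in absolute anabelian geometry III*, proof of Prop. 4.2 (i), kurims p. 106
(`paper:url-5493eb38cbb7`; bib key `MochizukiAbsTopIII2015`): the full subcategory of `EA` of objects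
mapping to `X` is identified with the finite étale localisations `Loc_R(X)`.  At the uniformised model
`X = ℍ/Γ̄` (abc-iut-L4-t14, `HolRS.isIdRigid_EA_mapsTo_pslQuotient_of_isFreeGroup` p449027 and its
RC twin p456078) the closers carry the FINITE-FIBRE hypothesis

  `hfin : ∀ (g : PSL₂(ℝ)) (Λ̄₁ Λ̄₂ : LocObj Γ̄), (∀ x ∈ Λ̄₁, g x g⁻¹ ∈ Λ̄₂) → [Λ̄₂ : g Λ̄₁ g⁻¹] < ∞`

(a morphism `ℍ/Λ̄₁ → ℍ/Λ̄₂`, `[τ] ↦ [g τ]`, has finite fibres).  This PROOF-ONLY file (no definition,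
no named fact, no instance) DISCHARGES `hfin` for every ARITHMETIC `Γ̄` — i.e. whenever the lift of
`Γ̄` to `GL(2, ℝ)` is commensurable with `SL(2, ℤ)` (Mathlib `Subgroup.IsArithmetic`); this covers
the `Γ(2)`-type uniformisation of the thrice-punctured sphere and all its finite étale covers — by the
classical cusp argument (G. Shimura, *Introduction to the arithmetic theory of automorphic functions*,
§1.5 and Prop. 3.2/§3.3: the commensurator of `SL(2, ℤ)` in `GL(2, ℝ)` is `ℝ^× · GL(2, ℚ)`):

* `HolRS.exists_eq_map_ratCast_mul_scalar` — an element of `GL(2, ℝ)` mapping `∞, 0, 1` into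
  `ℙ¹(ℚ) ⊂ ℙ¹(ℝ)` (Mathlib's `OnePoint ℝ` with its `GL(2, ℝ)`-action) is a real scalar multiple
  of a rational matrix (sharp `3`-transitivity; `OnePoint.exists_mem_SL2`);
* `HolRS.isArithmetic_conjAct_of_le` — if `h A h⁻¹ ≤ B` with `A`, `B` arithmetic, then `h` maps the
  cusps `ℙ¹(ℚ)` of `A` into the cusps `ℙ¹(ℚ)` of `B` (Mathlib `IsCusp.smul`,
  `Subgroup.IsArithmetic.isCusp_iff_isCusp_SL2Z`, `isCusp_SL2Z_iff`), so `h ∈ ℝ^× · GL(2, ℚ)` and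
  `h A h⁻¹` is arithmetic (Mathlib `Subgroup.IsArithmetic.conj`);
* `HolRS.finiteIndex_conjAct_subgroupOf_of_le` — hence `[B : h A h⁻¹] < ∞` (commensurability);
* ★ `HolRS.hfin_of_isArithmetic` — **`hfin` for arithmetic `Γ̄ ≤ PSL₂(ℝ)`**, in the exact binder shape
  of the consumers (abc-iut-L4-t14's `LocObj`, `conjSubgroup`), transported along
  `SL(2, ℝ) → PSL₂(ℝ)` and `SL(2, ℝ) ↪ GL(2, ℝ)` (finite-index subgroups of arithmetic groups are
  arithmetic: `HolRS.isArithmetic_map_comap_of_locObj`);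
* `HolRS.isArithmetic_map_comap_of_subgroup_SL2Z` — NON-VACUITY: the image in `PSL₂(ℝ)` of every
  finite-index `Λ ≤ SL(2, ℤ)` satisfies the arithmeticity hypothesis (its lift is `Λ·{±1}`).

abc-iut cell, row «HFIN-ARITH» (seat abc-iut-L4-t12; support for NODES [AbsTopIII] Prop 4.2 (i)/Cor 4.5
geometric `EA` column, campaign-L).  HONEST FRAMING: classical and undisputed (arithmetic Fuchsian
groups); MODEL side of [AbsTopIII] §4 only; model ≠ reconstruction; nothing here bears on
[IUTchIII] Cor. 3.12 or asserts anything about abc.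
-/

noncomputable section

open scoped MatrixGroups Pointwise
open Matrix Matrix.SpecialLinearGroup OnePoint

namespace Literature.AnabelianGeometry.AbsoluteAnabelian

namespace HolRS

/-! ### Elements of `GL(2, ℝ)` preserving three rational points of `ℙ¹(ℝ)` are real multiples of
rational matrices -/

set_option backward.isDefEq.respectTransparency false in
/-- `SL(2, ℤ)` preserves the rational points of `ℙ¹(ℝ)`. [cite: Shimura1971, §1.5] -/
theorem mapGL_smul_mem_range_ratCast (γ : SL(2, ℤ)) {c : OnePoint ℝ}
    (hc : c ∈ Set.range (OnePoint.map (Rat.cast : ℚ → ℝ))) :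
    mapGL ℝ γ • c ∈ Set.range (OnePoint.map (Rat.cast : ℚ → ℝ)) := by
  obtain ⟨q, rfl⟩ := hc
  refine ⟨mapGL ℚ γ • q, ?_⟩
  rw [← Rat.coe_castHom, OnePoint.map_smul, ← (Rat.castHom ℝ).algebraMap_toAlgebra, map_mapGL]

/-- If `OnePoint.map Rat.cast q = ↑x` then `x` is (the cast of) a rational number. [folklore] -/
private theorem exists_ratCast_eq_of_map_eq_coe {q : OnePoint ℚ} {x : ℝ}
    (h : OnePoint.map (Rat.cast : ℚ → ℝ) q = (x : OnePoint ℝ)) : ∃ r : ℚ, (r : ℝ) = x := by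
  cases q with
  | infty => simp at h
  | coe r => exact ⟨r, by simpa using h⟩

set_option backward.isDefEq.respectTransparency false in
/-- **An element of `GL(2, ℝ)` mapping `∞`, `0`, `1` to rational points of `ℙ¹(ℝ)` is a real scalar
multiple of a rational matrix** (sharp `3`-transitivity of `PGL₂` on `ℙ¹`). [cite: Shimura1971, §1.5] -/
theorem exists_eq_map_ratCast_mul_scalar (h : GL (Fin 2) ℝ)
    (hi : h • (∞ : OnePoint ℝ) ∈ Set.range (OnePoint.map (Rat.cast : ℚ → ℝ)))
    (h0 : h • ((0 : ℝ) : OnePoint ℝ) ∈ Set.range (OnePoint.map (Rat.cast : ℚ → ℝ)))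
    (h1 : h • ((1 : ℝ) : OnePoint ℝ) ∈ Set.range (OnePoint.map (Rat.cast : ℚ → ℝ))) :
    ∃ (m : GL (Fin 2) ℚ) (u : ℝˣ),
      h = m.map (Rat.castHom ℝ) * GeneralLinearGroup.scalar (Fin 2) u := by
  classical
  obtain ⟨q, hq⟩ := hi
  obtain ⟨γ, hγ⟩ := OnePoint.exists_mem_SL2 ℤ q
  -- `h₁ := γ⁻¹ h` fixes `∞` and still maps `0`, `1` to rational points
  obtain ⟨h₁, hh₁⟩ : ∃ h₁ : GL (Fin 2) ℝ, h₁ = mapGL ℝ γ⁻¹ * h := ⟨_, rfl⟩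
  have key : ∀ c : OnePoint ℝ, h • c ∈ Set.range (OnePoint.map (Rat.cast : ℚ → ℝ)) →
      h₁ • c ∈ Set.range (OnePoint.map (Rat.cast : ℚ → ℝ)) := by
    intro c hc
    rw [hh₁, mul_smul]
    exact mapGL_smul_mem_range_ratCast γ⁻¹ hc
  have h₁i : h₁ • (∞ : OnePoint ℝ) = ∞ := by
    rw [hh₁, mul_smul, ← hq, ← hγ, ← Rat.coe_castHom, OnePoint.map_smul, OnePoint.map_infty,
      ← (Rat.castHom ℝ).algebraMap_toAlgebra, map_mapGL, ← mul_smul, ← map_mul, inv_mul_cancel,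
      map_one, one_smul]
  have h10 : h₁ 1 0 = 0 := smul_infty_eq_self_iff.mp h₁i
  have hdet : h₁ 0 0 * h₁ 1 1 ≠ 0 := by
    have := h₁.det_ne_zero
    rwa [det_fin_two, h10, mul_zero, sub_zero] at this
  have h00 : h₁ 0 0 ≠ 0 := fun h => hdet (by rw [h, zero_mul])
  have h11 : h₁ 1 1 ≠ 0 := fun h => hdet (by rw [h, mul_zero])
  -- the images of `0` and `1`
  obtain ⟨q₀, hq₀⟩ := key _ h0
  obtain ⟨q₁, hq₁⟩ := key _ h1
  rw [smul_some_eq_ite, mul_zero, zero_add, if_neg h11, mul_zero, zero_add] at hq₀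
  rw [smul_some_eq_ite, mul_one, h10, zero_add, if_neg h11, mul_one] at hq₁
  obtain ⟨r₀, hr₀⟩ := exists_ratCast_eq_of_map_eq_coe hq₀
  obtain ⟨r₁, hr₁⟩ := exists_ratCast_eq_of_map_eq_coe hq₁
  -- `a = (r₁ - r₀) d ≠ 0`, `b = r₀ d`
  have h00' : h₁ 0 0 = ((r₁ : ℝ) - r₀) * h₁ 1 1 := by
    rw [hr₀, hr₁]; field_simp; ring
  have h01' : h₁ 0 1 = (r₀ : ℝ) * h₁ 1 1 := by
    rw [hr₀]; field_simp
  have hne : r₁ - r₀ ≠ 0 := by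
    intro h0'
    have : (r₁ : ℝ) - r₀ = 0 := by exact_mod_cast h0'
    rw [this, zero_mul] at h00'
    exact h00 h00'
  let m₁ : GL (Fin 2) ℚ := GeneralLinearGroup.mkOfDetNeZero !![r₁ - r₀, r₀; 0, 1]
    (by rw [det_fin_two_of]; simpa using hne)
  let u : ℝˣ := Units.mk0 (h₁ 1 1) h11
  have hm₁ : h₁ = m₁.map (Rat.castHom ℝ) * GeneralLinearGroup.scalar (Fin 2) u := by
    refine GeneralLinearGroup.ext fun i j => ?_
    rw [GeneralLinearGroup.coe_mul, Matrix.mul_apply, Fin.sum_univ_two,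
      GeneralLinearGroup.map_apply, GeneralLinearGroup.map_apply, GeneralLinearGroup.coe_scalar]
    fin_cases i <;> fin_cases j
    · simpa [m₁, u] using h00'
    · simpa [m₁, u] using h01'
    · simpa [m₁, u] using h10
    · simp [m₁, u]
  refine ⟨mapGL ℚ γ * m₁, u, ?_⟩
  calc h = mapGL ℝ γ * h₁ := by
        rw [hh₁, ← mul_assoc, ← map_mul, mul_inv_cancel, map_one, one_mul]
    _ = _ := by
      rw [hm₁, ← mul_assoc, map_mul, ← (Rat.castHom ℝ).algebraMap_toAlgebra, map_mapGL]

/-! ### A conjugate of an arithmetic group contained in an arithmetic group is arithmetic -/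

/-- Conjugation by a central element of `GL(2, ℝ)` (a scalar) does not move a subgroup. [folklore] -/
private theorem conjAct_scalar_smul (S : Subgroup (GL (Fin 2) ℝ)) (u : ℝˣ) :
    ConjAct.toConjAct (GeneralLinearGroup.scalar (Fin 2) u) • S = S := by
  apply Subgroup.conjAct_pointwise_smul_eq_self
  apply Subgroup.center_le_normalizer
  rw [GeneralLinearGroup.center_eq_range_scalar]
  exact ⟨u, rfl⟩

/-- An arithmetic subgroup and its conjugates by `GL(2, ℝ)` have cusp sets `ℙ¹(ℚ)` and
`h • ℙ¹(ℚ)`; so **if a conjugate `h A h⁻¹` of an arithmetic `A` lies in an arithmetic `B`, then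
`h` preserves `ℙ¹(ℚ)`**. [cite: Shimura1971, §1.5] -/
theorem smul_mem_range_ratCast_of_conjAct_le (A B : Subgroup (GL (Fin 2) ℝ)) [A.IsArithmetic]
    [B.IsArithmetic] (h : GL (Fin 2) ℝ) (hle : ConjAct.toConjAct h • A ≤ B) {c : OnePoint ℝ}
    (hc : c ∈ Set.range (OnePoint.map (Rat.cast : ℚ → ℝ))) :
    h • c ∈ Set.range (OnePoint.map (Rat.cast : ℚ → ℝ)) := by
  have hcA : IsCusp c A := by
    rw [Subgroup.IsArithmetic.isCusp_iff_isCusp_SL2Z, isCusp_SL2Z_iff]; exact hc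
  have := (hcA.smul h).mono hle
  rwa [Subgroup.IsArithmetic.isCusp_iff_isCusp_SL2Z, isCusp_SL2Z_iff] at this

/-- **If a conjugate `h A h⁻¹` (`h ∈ GL(2, ℝ)`) of an arithmetic subgroup `A` lies in an arithmetic
subgroup `B`, then `h ∈ ℝ^× · GL(2, ℚ)` and `h A h⁻¹` is itself arithmetic.** [cite: Shimura1971, §1.5] -/
theorem isArithmetic_conjAct_of_le (A B : Subgroup (GL (Fin 2) ℝ)) [A.IsArithmetic] [B.IsArithmetic]
    (h : GL (Fin 2) ℝ) (hle : ConjAct.toConjAct h • A ≤ B) :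
    (ConjAct.toConjAct h • A).IsArithmetic := by
  obtain ⟨m, u, hm⟩ := exists_eq_map_ratCast_mul_scalar h
    (smul_mem_range_ratCast_of_conjAct_le A B h hle ⟨∞, OnePoint.map_infty _⟩)
    (smul_mem_range_ratCast_of_conjAct_le A B h hle ⟨((0 : ℚ) : OnePoint ℚ), by simp⟩)
    (smul_mem_range_ratCast_of_conjAct_le A B h hle ⟨((1 : ℚ) : OnePoint ℚ), by simp⟩)
  rw [hm, map_mul, mul_smul, conjAct_scalar_smul]
  exact Subgroup.IsArithmetic.conj A m

/-- **`hfin` in `GL(2, ℝ)`**: if a conjugate `h A h⁻¹` of an arithmetic subgroup `A` lies in an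
arithmetic subgroup `B`, it has FINITE INDEX in `B` (both are commensurable with `SL(2, ℤ)`).
[cite: Shimura1971, §1.5] [cite: MochizukiAbsTopIII2015, Proposition 4.2 (i) proof p.106] -/
theorem finiteIndex_conjAct_subgroupOf_of_le (A B : Subgroup (GL (Fin 2) ℝ)) [A.IsArithmetic]
    [B.IsArithmetic] (h : GL (Fin 2) ℝ) (hle : ConjAct.toConjAct h • A ≤ B) :
    ((ConjAct.toConjAct h • A).subgroupOf B).FiniteIndex := by
  haveI := isArithmetic_conjAct_of_le A B h hle
  exact ⟨((Subgroup.IsArithmetic.is_commensurable (𝒢 := ConjAct.toConjAct h • A)).trans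
    (Subgroup.IsArithmetic.is_commensurable (𝒢 := B)).symm).1⟩

/-! ### Transport to `PSL₂(ℝ)`: `hfin` for arithmetic `Γ̄` -/

section PSL

open Literature.Geometry.Manifold.QuotientManifold (conjSubgroup conj_mem_conjSubgroup)

/-- A finite-index subgroup `Λ̄ ≤ Γ̄` of an arithmetic `Γ̄ ≤ PSL₂(ℝ)` is arithmetic (its lift to
`GL(2, ℝ)` has finite index in the lift of `Γ̄`). [cite: Shimura1971, §1.5] -/
theorem isArithmetic_map_comap_of_locObj (Γ : Subgroup PSL2R)
    [hΓ : ((Γ.comap (QuotientGroup.mk' (Subgroup.center SL(2, ℝ)))).map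
      (toGL : SL(2, ℝ) →* GL (Fin 2) ℝ)).IsArithmetic]
    (Λ : _root_.Literature.AnabelianGeometry.AbsoluteAnabelian.LocObj Γ) :
    ((Λ.toSubgroup.comap (QuotientGroup.mk' (Subgroup.center SL(2, ℝ)))).map
      (toGL : SL(2, ℝ) →* GL (Fin 2) ℝ)).IsArithmetic := by
  haveI := Λ.finiteIndex
  have hle : (Λ.toSubgroup.comap (QuotientGroup.mk' (Subgroup.center SL(2, ℝ)))).map
      (toGL : SL(2, ℝ) →* GL (Fin 2) ℝ) ≤
      (Γ.comap (QuotientGroup.mk' (Subgroup.center SL(2, ℝ)))).map toGL :=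
    Subgroup.map_mono (Subgroup.comap_mono Λ.le)
  have hidx : ((Λ.toSubgroup.comap (QuotientGroup.mk' (Subgroup.center SL(2, ℝ)))).map
      (toGL : SL(2, ℝ) →* GL (Fin 2) ℝ)).relIndex
      ((Γ.comap (QuotientGroup.mk' (Subgroup.center SL(2, ℝ)))).map toGL) ≠ 0 := by
    rw [Subgroup.relIndex_map_map_of_injective _ _ toGL_injective, Subgroup.relIndex_comap,
      Subgroup.map_comap_eq_self_of_surjective (QuotientGroup.mk'_surjective _)]
    exact Subgroup.FiniteIndex.index_ne_zero
  refine ⟨Subgroup.Commensurable.trans ⟨hidx, ?_⟩ hΓ.is_commensurable⟩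
  rw [Subgroup.relIndex_eq_one.mpr hle]
  exact one_ne_zero

/-- **`hfin` for ARITHMETIC `Γ̄ ≤ PSL₂(ℝ)`** (the finite-fibre hypothesis of the uniformised
geometric `EA` column, abc-iut-L4-t14 p449027/p456078, DISCHARGED when the lift of `Γ̄` to `GL(2, ℝ)`
is commensurable with `SL(2, ℤ)`): for `g ∈ PSL₂(ℝ)` and finite-index `Λ̄₁, Λ̄₂ ≤ Γ̄` with
`g Λ̄₁ g⁻¹ ≤ Λ̄₂`, the index `[Λ̄₂ : g Λ̄₁ g⁻¹]` is finite — `g` preserves `ℙ¹(ℚ)`, hence lies in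
`ℝ^× · GL(2, ℚ)`, hence `g Λ̄₁ g⁻¹` is again arithmetic and so commensurable with `Λ̄₂`.
[cite: Shimura1971, §1.5] [cite: MochizukiAbsTopIII2015, Proposition 4.2 (i) proof p.106] -/
theorem hfin_of_isArithmetic (Γ : Subgroup PSL2R)
    [hΓ : ((Γ.comap (QuotientGroup.mk' (Subgroup.center SL(2, ℝ)))).map
      (toGL : SL(2, ℝ) →* GL (Fin 2) ℝ)).IsArithmetic]
    (g : PSL2R) (Λ₁ Λ₂ : _root_.Literature.AnabelianGeometry.AbsoluteAnabelian.LocObj Γ)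
    (hg : ∀ x ∈ Λ₁.toSubgroup, g * x * g⁻¹ ∈ Λ₂.toSubgroup) :
    ((conjSubgroup g Λ₁.toSubgroup).subgroupOf Λ₂.toSubgroup).FiniteIndex := by
  classical
  haveI := isArithmetic_map_comap_of_locObj Γ Λ₁
  haveI := isArithmetic_map_comap_of_locObj Γ Λ₂
  obtain ⟨g', rfl⟩ := QuotientGroup.mk'_surjective (Subgroup.center SL(2, ℝ)) g
  set π : SL(2, ℝ) →* PSL2R := QuotientGroup.mk' (Subgroup.center SL(2, ℝ)) with hπ
  -- the conjugated lift lies in the lift of `Λ̄₂`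
  have hle : ConjAct.toConjAct (toGL g') • (Λ₁.toSubgroup.comap π).map
      (toGL : SL(2, ℝ) →* GL (Fin 2) ℝ) ≤ (Λ₂.toSubgroup.comap π).map toGL := by
    intro y hy
    obtain ⟨s, hs, rfl⟩ := (Subgroup.mem_smul_pointwise_iff_exists _ _ _).mp hy
    obtain ⟨x, hx, rfl⟩ := Subgroup.mem_map.mp hs
    rw [ConjAct.toConjAct_smul, ← map_inv, ← map_mul, ← map_mul]
    refine Subgroup.mem_map_of_mem _ ?_
    rw [Subgroup.mem_comap, map_mul, map_mul, map_inv]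
    exact hg _ (Subgroup.mem_comap.mp hx)
  -- finite index at the `GL(2, ℝ)` level
  have hfi := finiteIndex_conjAct_subgroupOf_of_le _ _ (toGL g') hle
  -- the conjugated lift is the lift of the conjugate
  have hC : ConjAct.toConjAct (toGL g') • (Λ₁.toSubgroup.comap π).map
      (toGL : SL(2, ℝ) →* GL (Fin 2) ℝ) = (conjSubgroup g' (Λ₁.toSubgroup.comap π)).map toGL := by
    ext y
    constructor
    · intro hy
      obtain ⟨s, hs, rfl⟩ := (Subgroup.mem_smul_pointwise_iff_exists _ _ _).mp hy
      obtain ⟨x, hx, rfl⟩ := Subgroup.mem_map.mp hs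
      rw [ConjAct.toConjAct_smul, ← map_inv, ← map_mul, ← map_mul]
      exact Subgroup.mem_map_of_mem _ (conj_mem_conjSubgroup g' _ x hx)
    · intro hy
      obtain ⟨z, hz, rfl⟩ := Subgroup.mem_map.mp hy
      obtain ⟨x, hx, rfl⟩ := Subgroup.mem_map.mp hz
      change toGL (g' * x * g'⁻¹) ∈ _
      rw [map_mul, map_mul, map_inv, ← ConjAct.toConjAct_smul]
      exact Subgroup.smul_mem_pointwise_smul _ _ _ (Subgroup.mem_map_of_mem _ hx)
  have h1 : (conjSubgroup g' (Λ₁.toSubgroup.comap π)).relIndex (Λ₂.toSubgroup.comap π) ≠ 0 := by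
    rw [← Subgroup.relIndex_map_map_of_injective _ _ toGL_injective, ← hC]
    exact hfi.index_ne_zero
  -- the lift of the conjugate lies in the preimage of the conjugate in `PSL₂(ℝ)`
  have h2 : conjSubgroup g' (Λ₁.toSubgroup.comap π) ≤
      (conjSubgroup (π g') Λ₁.toSubgroup).comap π := by
    intro z hz
    obtain ⟨x, hx, rfl⟩ := Subgroup.mem_map.mp hz
    rw [Subgroup.mem_comap]
    change π (g' * x * g'⁻¹) ∈ conjSubgroup (π g') Λ₁.toSubgroup
    rw [map_mul, map_mul, map_inv]
    exact conj_mem_conjSubgroup (π g') _ (π x) (Subgroup.mem_comap.mp hx)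
  have h3 : ((conjSubgroup (π g') Λ₁.toSubgroup).comap π).relIndex
      (Λ₂.toSubgroup.comap π) ≠ 0 := by
    intro h0
    have := Subgroup.relIndex_dvd_of_le_left (L := Λ₂.toSubgroup.comap π) h2
    rw [h0] at this
    exact h1 (Nat.eq_zero_of_zero_dvd this)
  -- back down along `π`
  rw [Subgroup.relIndex_comap,
    Subgroup.map_comap_eq_self_of_surjective (QuotientGroup.mk'_surjective _)] at h3
  exact ⟨h3⟩

/-- **Non-vacuity of the arithmeticity hypothesis**: the image `Γ̄ ≤ PSL₂(ℝ)` of any finite-index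
subgroup `Λ ≤ SL(2, ℤ)` (e.g. `Γ(2)`, uniformising the thrice-punctured sphere, or any principal
congruence subgroup) is arithmetic in the above sense — its lift to `GL(2, ℝ)` is `Λ·{±1}`,
commensurable with `SL(2, ℤ)`. [cite: Shimura1971, §1.5] -/
theorem isArithmetic_map_comap_of_subgroup_SL2Z (Λ : Subgroup SL(2, ℤ)) [Λ.FiniteIndex] :
    ((((Λ.map (Matrix.SpecialLinearGroup.map (Int.castRingHom ℝ))).map
        (QuotientGroup.mk' (Subgroup.center SL(2, ℝ)))).comap
        (QuotientGroup.mk' (Subgroup.center SL(2, ℝ)))).map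
      (toGL : SL(2, ℝ) →* GL (Fin 2) ℝ)).IsArithmetic := by
  rw [Subgroup.comap_map_eq, QuotientGroup.ker_mk', Subgroup.map_sup, Subgroup.map_map]
  -- `Λ.map (toGL ∘ cast) = ↑Λ`
  have hΛ : Λ.map ((toGL : SL(2, ℝ) →* GL (Fin 2) ℝ).comp
      (Matrix.SpecialLinearGroup.map (Int.castRingHom ℝ))) = (Λ : Subgroup (GL (Fin 2) ℝ)) := rfl
  rw [hΛ]
  set M : Subgroup (GL (Fin 2) ℝ) := (Λ : Subgroup (GL (Fin 2) ℝ)) ⊔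
    (Subgroup.center SL(2, ℝ)).map (toGL : SL(2, ℝ) →* GL (Fin 2) ℝ) with hM
  -- `↑Λ ≤ M ≤ (↑Λ)±`
  have h1 : (Λ : Subgroup (GL (Fin 2) ℝ)) ≤ M := le_sup_left
  have h2 : M ≤ (Λ : Subgroup (GL (Fin 2) ℝ)).adjoinNegOne := by
    refine sup_le (Subgroup.le_adjoinNegOne _) ?_
    rintro _ ⟨z, hz, rfl⟩
    rcases mem_center_sl_iff.mp hz with rfl | rfl
    · rw [map_one]; exact Subgroup.one_mem _
    · rw [Subgroup.mem_adjoinNegOne_iff]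
      right
      have : -((toGL : SL(2, ℝ) →* GL (Fin 2) ℝ) (-1)) = 1 := by
        refine Units.ext ?_
        simp
      rw [this]
      exact Subgroup.one_mem _
  have hcomm : Subgroup.Commensurable M (Λ : Subgroup (GL (Fin 2) ℝ)) := by
    refine ⟨by rw [Subgroup.relIndex_eq_one.mpr h1]; exact one_ne_zero, fun h0 => ?_⟩
    exact (Λ : Subgroup (GL (Fin 2) ℝ)).relIndex_adjoinNegOne_ne_zero
      (Subgroup.relIndex_eq_zero_of_le_right h2 h0)
  exact ⟨hcomm.trans Subgroup.IsArithmetic.is_commensurable⟩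

/-- **`hfin` at the image `Γ̄ = π(Λ)` of any finite-index `Λ ≤ SL(2, ℤ)`** — the turnkey form for
the explicit arithmetic bases (abc-iut-L4-d1's `Γ̄(2) := π(Γ(2))`, row «J2i-GAMMA2-MODEL», is the case
`Λ := CongruenceSubgroup.Gamma 2`): the finite-fibre hypothesis of abc-iut-L4-t14's uniformised
closers holds with NO residual hypothesis. [cite: Shimura1971, §1.5]
[cite: MochizukiAbsTopIII2015, Proposition 4.2 (i) proof p.106] -/
theorem hfin_of_subgroup_SL2Z (Λ : Subgroup SL(2, ℤ)) [Λ.FiniteIndex] :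
    ∀ (g : PSL2R) (Λ₁ Λ₂ : _root_.Literature.AnabelianGeometry.AbsoluteAnabelian.LocObj
      ((Λ.map (Matrix.SpecialLinearGroup.map (Int.castRingHom ℝ))).map
        (QuotientGroup.mk' (Subgroup.center SL(2, ℝ))))),
      (∀ x ∈ Λ₁.toSubgroup, g * x * g⁻¹ ∈ Λ₂.toSubgroup) →
      ((conjSubgroup g Λ₁.toSubgroup).subgroupOf Λ₂.toSubgroup).FiniteIndex := by
  haveI := isArithmetic_map_comap_of_subgroup_SL2Z Λ
  exact hfin_of_isArithmetic _

/-- **`hfin` at `Γ̄(2) = π(Γ(2))`** (abc-iut-L4-d1's explicit cusped base, written out in full as in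
`ArchimedeanHolFieldFunctorGeometricPSLGammaTwo.lean`), with no residual hypothesis.
[cite: Shimura1971, §1.5] [cite: MochizukiAbsTopIII2015, Proposition 4.2 (i) proof p.106] -/
theorem hfin_pslGamma_two :
    ∀ (g : PSL2R) (Λ₁ Λ₂ : _root_.Literature.AnabelianGeometry.AbsoluteAnabelian.LocObj
      (((CongruenceSubgroup.Gamma 2).map (Matrix.SpecialLinearGroup.map (Int.castRingHom ℝ))).map
        (QuotientGroup.mk' (Subgroup.center SL(2, ℝ))))),
      (∀ x ∈ Λ₁.toSubgroup, g * x * g⁻¹ ∈ Λ₂.toSubgroup) →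
      ((conjSubgroup g Λ₁.toSubgroup).subgroupOf Λ₂.toSubgroup).FiniteIndex :=
  hfin_of_subgroup_SL2Z (CongruenceSubgroup.Gamma 2)

end PSL

end HolRS

end Literature.AnabelianGeometry.AbsoluteAnabelian

end
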